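import Summits.KontsevichZagierPeriods.Zeta5Search.LaiSweepShard

/-!
# `κ₃` sweep certificate — shard file 060 of 127 (shards 420–426 of 889)

HONEST FRAMING. Systematic search; no irrationality claim unless certified. This file only checks,
by `decide +kernel`, shards 420–426 of the order-cell sweep of the `κ₃` point `(74, 2180, 444; δ74)`
(engine `LaiSweepEngine`, soundness `LaiSweepJump/Free/Eval/Shard/Kappa3`; a shard is `⟨regime, n,
p, q, p', q', Lo, Up⟩`: `n` cells from `p/q` to `p'/q'` with integer rate sums in `[Lo, Up]`, `K =
128`, `D = 2^40`). It draws NO conclusion: only the capstone `LaiKappa3SweepCert`, which needs all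
127 shard files, does. Kernel cost of this file ≈ 560 cells × 0.3 s.
-/

namespace Summit.KontsevichZagierPeriods.Zeta5Search.Sweep

set_option maxHeartbeats 100000000 in
/-- Shard 420: 80 cells of regime B from `103/251` to `128/311`.
[cite: Lai2024BallRivoal, §4 Lemma 4.3] -/
theorem shard420 :
    Shard.check 128 (2^40)
      ⟨true, 80, 103, 251, 128, 311, 16886617011819, 19308283374736⟩ = true := by
  decide +kernel

set_option maxHeartbeats 100000000 in
/-- Shard 421: 80 cells of regime B from `128/311` to `109/264`.
[cite: Lai2024BallRivoal, §4 Lemma 4.3] -/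
theorem shard421 :
    Shard.check 128 (2^40)
      ⟨true, 80, 128, 311, 109, 264, 18044152651976, 20649744680935⟩ = true := by
  decide +kernel

set_option maxHeartbeats 100000000 in
/-- Shard 422: 80 cells of regime B from `109/264` to `152/367`.
[cite: Lai2024BallRivoal, §4 Lemma 4.3] -/
theorem shard422 :
    Shard.check 128 (2^40)
      ⟨true, 80, 109, 264, 152, 367, 17813207120017, 20402549732714⟩ = true := by
  decide +kernel

set_option maxHeartbeats 100000000 in
/-- Shard 423: 80 cells of regime B from `152/367` to `157/378`.
[cite: Lai2024BallRivoal, §4 Lemma 4.3] -/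
theorem shard423 :
    Shard.check 128 (2^40)
      ⟨true, 80, 152, 367, 157, 378, 16190765510277, 18559297036526⟩ = true := by
  decide +kernel

set_option maxHeartbeats 100000000 in
/-- Shard 424: 80 cells of regime B from `157/378` to `182/437`.
[cite: Lai2024BallRivoal, §4 Lemma 4.3] -/
theorem shard424 :
    Shard.check 128 (2^40)
      ⟨true, 80, 157, 378, 182, 437, 15553568605182, 17842529099841⟩ = true := by
  decide +kernel

set_option maxHeartbeats 100000000 in
/-- Shard 425: 80 cells of regime B from `182/437` to `173/414`.
[cite: Lai2024BallRivoal, §4 Lemma 4.3] -/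
theorem shard425 :
    Shard.check 128 (2^40)
      ⟨true, 80, 182, 437, 173, 414, 19161919046699, 22001398763266⟩ = true := by
  decide +kernel

set_option maxHeartbeats 100000000 in
/-- Shard 426: 80 cells of regime B from `173/414` to `184/439`.
[cite: Lai2024BallRivoal, §4 Lemma 4.3] -/
theorem shard426 :
    Shard.check 128 (2^40)
      ⟨true, 80, 173, 414, 184, 439, 17236992781400, 19808175542497⟩ = true := by
  decide +kernel

/-- The checked shards of this file, in order. [folklore] -/
def shards060 : List (CheckedShard 128 (2^40)) :=
  [⟨_, shard420⟩, ⟨_, shard421⟩, ⟨_, shard422⟩, ⟨_, shard423⟩, ⟨_, shard424⟩,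
    ⟨_, shard425⟩, ⟨_, shard426⟩]

end Summit.KontsevichZagierPeriods.Zeta5Search.Sweep
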